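import Mathlib.GroupTheory.SpecificGroups.Quaternion
import Mathlib.Tactic.Linarith
import Mathlib.Tactic.Ring
import Mathlib.Tactic.Positivity
import Mathlib.Tactic.IntervalCases
import Literature.Combinatorics.Additive.TripleProductProperty
import Summits.MatrixMultiplication.OmegaCensus.DihedralLikeTPPBound
import Summits.MatrixMultiplication.OmegaCensus.DihedralLikeTiling
import Summits.MatrixMultiplication.OmegaCensus.DihedralLawModThree
import Summits.MatrixMultiplication.OmegaCensus.DihedralLawModOne
import Summits.MatrixMultiplication.OmegaCensus.Dihedral8TPPVolume
import HarnessLib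

/-!
# `β(G) ≤ 4⌊|G|/3⌋` for every generalized dihedral / generalized dicyclic group

ω-census, family (b3).  Framing: lottery ticket; floor = certified bounds/negative ranges.

The census's Conjecture′ ("`β(G) ≤ 4⌊|G|/3⌋` whenever `G` has an abelian subgroup of index `2`") is false in
general (`C₄ ≀ C₂` has `ρ = 3/2`; seat notes, Murthy arXiv:2512.16730 §5), but it is TRUE — and is proved here in
the kernel — on the whole *inverting* class: every group with a dihedral-like presentation `G = ρ(A) ⊔ τ(A)` over a
finite abelian group `A` with `|A| ≥ 2` (`ρaρb = ρ(a+b)`, `ρaτb = τ(b−a)`, `τaρb = τ(a+b)`, `τaτb = ρ(c₀+b−a)`;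
generalized dihedral `Dih(A)`, generalized dicyclic, in particular `D_{2n}` and `Q_{4n}`) satisfies
`|S||T||U| ≤ 4⌊2|A|/3⌋ = 4⌊|G|/3⌋` for every TPP triple (`tpp_volume_le_law_dihedralLike`).

Proof = the dihedral one run over `A`: counting constraints (`parts_counting'`), the arithmetic cores `core_nat`,
`core_nat_mod_three`, `avec_mod_one`, the Fourier obstruction `three_dvd_of_double_tiling'` for `|A| ≡ 1 (mod 3)`,
`|A| ≥ 7`, and the pair packing bound `|X||Y| ≤ |G|` for `|A| ∈ {2, 4}`.  Instance: `tpp_volume_le_law_quaternion`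
(`β(Q_{4n}) ≤ 4⌊4n/3⌋`; exact for `Q₈, Dic₁₂, Dic₂₀, Dic₂₄` by the census's witnesses, strict for `Q₁₆`).
-/

namespace Summit.MatrixMultiplication.OmegaCensus

open Literature.Combinatorics.Additive Finset

/-! ## Small cases by packing -/

/-- `|A| = 4`: pairwise packing `≤ 8` and `3abc ≤ 32` force `abc ≤ 8`. [folklore] -/
theorem volume_le_eight_of_packing (a b c : ℕ) (hab : a * b ≤ 8) (hbc : b * c ≤ 8) (hca : c * a ≤ 8)
    (h3 : 3 * (a * b * c) ≤ 32) : a * b * c ≤ 8 := by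
  rcases Nat.eq_zero_or_pos a with rfl | ha; · simp
  rcases Nat.eq_zero_or_pos b with rfl | hb; · simp
  rcases Nat.eq_zero_or_pos c with rfl | hc; · simp
  have ha8 : a ≤ 8 := by nlinarith
  have hb8 : b ≤ 8 := by nlinarith
  interval_cases a <;> interval_cases b <;> omega

/-- `|A| = 2`: pairwise packing `≤ 4` and `3abc ≤ 16` force `abc ≤ 4`. [folklore] -/
theorem volume_le_four_of_packing (a b c : ℕ) (hab : a * b ≤ 4) (hbc : b * c ≤ 4) (hca : c * a ≤ 4)
    (h3 : 3 * (a * b * c) ≤ 16) : a * b * c ≤ 4 := by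
  rcases Nat.eq_zero_or_pos a with rfl | ha; · simp
  rcases Nat.eq_zero_or_pos b with rfl | hb; · simp
  rcases Nat.eq_zero_or_pos c with rfl | hc; · simp
  have ha4 : a ≤ 4 := by nlinarith
  have hb4 : b ≤ 4 := by nlinarith
  interval_cases a <;> interval_cases b <;> omega

section DihedralLike

variable {A : Type*} [AddCommGroup A] [DecidableEq A] [Fintype A] {G : Type} [Group G] [DecidableEq G]
  {ρ τ : A → G} {c₀ : A} {S T U : Finset G}

omit [AddCommGroup A] [DecidableEq A] [Group G] [DecidableEq G] in
/-- `|G| = 2|A|` for a dihedral-like presentation. [folklore] -/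
theorem card_eq_two_mul_of_dihedralLike [Fintype G] (hρ : Function.Injective ρ) (hτ : Function.Injective τ)
    (hne : ∀ a b, ρ a ≠ τ b) (hsurj : ∀ g, (∃ a, ρ a = g) ∨ (∃ a, τ a = g)) :
    Fintype.card G = 2 * Fintype.card A := by
  rw [two_mul, ← Fintype.card_sum]
  refine (Fintype.card_congr (Equiv.ofBijective (Sum.elim ρ τ) ⟨?_, ?_⟩)).symm
  · rintro (a | a) (b | b) hab
    · exact congrArg Sum.inl (hρ hab)
    · exact absurd hab (hne a b)
    · exact absurd hab.symm (hne b a)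
    · exact congrArg Sum.inr (hτ hab)
  · intro g
    rcases hsurj g with ⟨a, rfl⟩ | ⟨a, rfl⟩
    exacts [⟨Sum.inl a, rfl⟩, ⟨Sum.inr a, rfl⟩]

set_option maxHeartbeats 400000 in
/-- The `|A| ≡ 1 (mod 3)`, `|A| ≥ 7` case: the excess configuration would be a double tiling with non-empty parts
(`avec_mod_one`), impossible by `three_dvd_of_double_tiling'`. [folklore] -/
theorem tpp_volume_le_law_dihedralLike_mod_one
    (hρρ : ∀ a b, ρ a * ρ b = ρ (a + b)) (hρτ : ∀ a b, ρ a * τ b = τ (b - a))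
    (hτρ : ∀ a b, τ a * ρ b = τ (a + b)) (hττ : ∀ a b, τ a * τ b = ρ (c₀ + b - a))
    (hρ : Function.Injective ρ) (hτ : Function.Injective τ) (hne : ∀ a b, ρ a ≠ τ b)
    (hsurj : ∀ g, (∃ a, ρ a = g) ∨ (∃ a, τ a = g)) (hmod : Fintype.card A % 3 = 1) (h7 : 7 ≤ Fintype.card A)
    (h : TripleProductProperty S T U) :
    S.card * T.card * U.card ≤ 4 * (2 * Fintype.card A / 3) := by
  set N := Fintype.card A with hNdef
  obtain ⟨h₀, h₃, h₁, h₂⟩ := parts_counting' hρρ hρτ hτρ hττ hρ hτ hne h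
  by_contra hgt
  have hV : 8 * N - 5 ≤ 3 * (S.card * T.card * U.card) := by omega
  rw [card_eq_parts' hρ hτ hne hsurj S, card_eq_parts' hρ hτ hne hsurj T, card_eq_parts' hρ hτ hne hsurj U] at hV
  set s₀ := (univ.filter fun a : A => ρ a ∈ S).card
  set s₁ := (univ.filter fun a : A => τ a ∈ S).card
  set t₀ := (univ.filter fun a : A => ρ a ∈ T).card
  set t₁ := (univ.filter fun a : A => τ a ∈ T).card
  set u₀ := (univ.filter fun a : A => ρ a ∈ U).card
  set u₁ := (univ.filter fun a : A => τ a ∈ U).card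
  have hN₁ : 3 * ((s₀ * t₀ * u₀ : ℕ) : ℤ) * ((s₀ * t₁ * u₁ + s₁ * t₀ * u₁ + s₁ * t₁ * u₀ : ℕ) : ℤ) ≤
      ((s₁ * t₀ * u₀ + s₀ * t₁ * u₀ + s₀ * t₀ * u₁ : ℕ) : ℤ) ^ 2 := by
    push_cast
    nlinarith [sq_nonneg ((s₁ * t₀ * u₀ : ℤ) - s₀ * t₁ * u₀), sq_nonneg ((s₀ * t₁ * u₀ : ℤ) - s₀ * t₀ * u₁),
      sq_nonneg ((s₀ * t₀ * u₁ : ℤ) - s₁ * t₀ * u₀)]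
  have hN₂ : 3 * ((s₁ * t₀ * u₀ + s₀ * t₁ * u₀ + s₀ * t₀ * u₁ : ℕ) : ℤ) * ((s₁ * t₁ * u₁ : ℕ) : ℤ) ≤
      ((s₀ * t₁ * u₁ + s₁ * t₀ * u₁ + s₁ * t₁ * u₀ : ℕ) : ℤ) ^ 2 := by
    push_cast
    nlinarith [sq_nonneg ((s₀ * t₁ * u₁ : ℤ) - s₁ * t₀ * u₁), sq_nonneg ((s₁ * t₀ * u₁ : ℤ) - s₁ * t₁ * u₀),
      sq_nonneg ((s₁ * t₁ * u₀ : ℤ) - s₀ * t₁ * u₁)]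
  have hV' : 8 * (N : ℤ) - 5 ≤ 3 * (((s₀ * t₀ * u₀ : ℕ) : ℤ) +
      ((s₁ * t₀ * u₀ + s₀ * t₁ * u₀ + s₀ * t₀ * u₁ : ℕ) : ℤ) +
      ((s₀ * t₁ * u₁ + s₁ * t₀ * u₁ + s₁ * t₁ * u₀ : ℕ) : ℤ) + ((s₁ * t₁ * u₁ : ℕ) : ℤ)) := by
    have e : (s₀ + s₁) * (t₀ + t₁) * (u₀ + u₁) = s₀ * t₀ * u₀ + (s₁ * t₀ * u₀ + s₀ * t₁ * u₀ + s₀ * t₀ * u₁) +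
        (s₀ * t₁ * u₁ + s₁ * t₀ * u₁ + s₁ * t₁ * u₀) + s₁ * t₁ * u₁ := by ring
    rw [e] at hV
    omega
  obtain ⟨hA1, hA2, hA0, hA3, hsum⟩ := avec_mod_one N _ _ _ _ (by positivity) (by positivity)
    (by positivity) (by positivity) (by exact_mod_cast h₀) (by exact_mod_cast h₁) (by exact_mod_cast h₂)
    (by exact_mod_cast h₃) hN₁ hN₂ (by exact_mod_cast hmod) (by exact_mod_cast h7) hV'
  have hA1n : s₁ * t₀ * u₀ + s₀ * t₁ * u₀ + s₀ * t₀ * u₁ = N := by exact_mod_cast hA1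
  have hA2n : s₀ * t₁ * u₁ + s₁ * t₀ * u₁ + s₁ * t₁ * u₀ = N := by exact_mod_cast hA2
  have hA0ne : s₀ * t₀ * u₀ ≠ 0 := by
    have : (1 : ℤ) ≤ ((s₀ * t₀ * u₀ : ℕ) : ℤ) := by omega
    have : 1 ≤ s₀ * t₀ * u₀ := by exact_mod_cast this
    omega
  have hA3ne : s₁ * t₁ * u₁ ≠ 0 := by
    have : (1 : ℤ) ≤ ((s₁ * t₁ * u₁ : ℕ) : ℤ) := by omega
    have : 1 ≤ s₁ * t₁ * u₁ := by exact_mod_cast this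
    omega
  have ne : ∀ {X : Finset A}, X.card ≠ 0 → X.Nonempty := fun h => card_pos.mp (Nat.pos_of_ne_zero h)
  have h3 := three_dvd_of_double_tiling' hρρ hρτ hτρ hττ hρ hτ hne h
    (ne (left_ne_zero_of_mul (left_ne_zero_of_mul hA0ne))) (ne (left_ne_zero_of_mul (left_ne_zero_of_mul hA3ne)))
    (ne (right_ne_zero_of_mul (left_ne_zero_of_mul hA0ne))) (ne (right_ne_zero_of_mul (left_ne_zero_of_mul hA3ne)))
    (ne (right_ne_zero_of_mul hA0ne)) (ne (right_ne_zero_of_mul hA3ne)) hA1n hA2n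
  omega

/-- **`β(G) ≤ 4⌊|G|/3⌋` on the inverting class.** For every group with a dihedral-like presentation over a finite
abelian group `A` with `|A| ≥ 2` (generalized dihedral / generalized dicyclic), every TPP triple satisfies
`|S||T||U| ≤ 4⌊2|A|/3⌋ = 4⌊|G|/3⌋. [folklore] -/
theorem tpp_volume_le_law_dihedralLike [Fintype G]
    (hρρ : ∀ a b, ρ a * ρ b = ρ (a + b)) (hρτ : ∀ a b, ρ a * τ b = τ (b - a))
    (hτρ : ∀ a b, τ a * ρ b = τ (a + b)) (hττ : ∀ a b, τ a * τ b = ρ (c₀ + b - a))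
    (hρ : Function.Injective ρ) (hτ : Function.Injective τ) (hne : ∀ a b, ρ a ≠ τ b)
    (hsurj : ∀ g, (∃ a, ρ a = g) ∨ (∃ a, τ a = g)) (hA : 2 ≤ Fintype.card A)
    (h : TripleProductProperty S T U) :
    S.card * T.card * U.card ≤ 4 * (2 * Fintype.card A / 3) := by
  set N := Fintype.card A with hNdef
  have h8 := tpp_volume_le_of_dihedralLike hρρ hρτ hτρ hττ hρ hτ hne hsurj h
  have hG : Fintype.card G = 2 * N := card_eq_two_mul_of_dihedralLike hρ hτ hne hsurj
  by_cases hmod1 : N % 3 = 1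
  · by_cases h7 : 7 ≤ N
    · exact tpp_volume_le_law_dihedralLike_mod_one hρρ hρτ hτρ hττ hρ hτ hne hsurj hmod1 h7 h
    · -- `N = 4`: packing
      have hN4 : N = 4 := by omega
      rcases Nat.eq_zero_or_pos S.card with hS0 | hSp
      · simp [hS0]
      rcases Nat.eq_zero_or_pos T.card with hT0 | hTp
      · simp [hT0]
      rcases Nat.eq_zero_or_pos U.card with hU0 | hUp
      · simp [hU0]
      have h1 : S.card * T.card ≤ 8 := by
        have := tpp_card_mul_card_le h hUp.ne'; rw [hG, hN4] at this; exact this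
      have h2 : T.card * U.card ≤ 8 := by
        have := tpp_card_mul_card_le h.rotate hSp.ne'; rw [hG, hN4] at this; exact this
      have h3 : U.card * S.card ≤ 8 := by
        have := tpp_card_mul_card_le h.rotate.rotate hTp.ne'; rw [hG, hN4] at this; exact this
      rw [hN4]
      exact volume_le_eight_of_packing _ _ _ h1 h2 h3 (by omega)
  · by_cases hmod2 : N % 3 = 2
    · rcases eq_or_lt_of_le hA with hN2 | hN3
      · -- `N = 2`: packing
        rcases Nat.eq_zero_or_pos S.card with hS0 | hSp
        · simp [hS0]
        rcases Nat.eq_zero_or_pos T.card with hT0 | hTp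
        · simp [hT0]
        rcases Nat.eq_zero_or_pos U.card with hU0 | hUp
        · simp [hU0]
        have h1 : S.card * T.card ≤ 4 := by
          have := tpp_card_mul_card_le h hUp.ne'; rw [hG, ← hN2] at this; exact this
        have h2 : T.card * U.card ≤ 4 := by
          have := tpp_card_mul_card_le h.rotate hSp.ne'; rw [hG, ← hN2] at this; exact this
        have h3 : U.card * S.card ≤ 4 := by
          have := tpp_card_mul_card_le h.rotate.rotate hTp.ne'; rw [hG, ← hN2] at this; exact this
        rw [← hN2]
        exact volume_le_four_of_packing _ _ _ h1 h2 h3 (by omega)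
      · obtain ⟨h₀, h₃, h₁, h₂⟩ := parts_counting' hρρ hρτ hτρ hττ hρ hτ hne h
        have := core_nat_mod_three N _ _ _ _ _ _ hmod2 h₀ h₃ h₁ h₂
        rw [card_eq_parts' hρ hτ hne hsurj S, card_eq_parts' hρ hτ hne hsurj T, card_eq_parts' hρ hτ hne hsurj U]
        omega
    · -- `3 ∣ N`
      omega

end DihedralLike

/-! ## Instance: dicyclic groups -/

/-- **`β(Q_{4n}) ≤ 4⌊4n/3⌋ = 4⌊|Q_{4n}|/3⌋`** for every `n ≥ 1` and every TPP triple of `QuaternionGroup n`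
(`A = ZMod 2n`, `c₀ = n`). Exact for `Q₈, Dic₁₂, Dic₂₀, Dic₂₄` (census witnesses), strict for `Q₁₆`. [folklore] -/
theorem tpp_volume_le_law_quaternion {n : ℕ} [NeZero n] {S T U : Finset (QuaternionGroup n)}
    (h : TripleProductProperty S T U) : S.card * T.card * U.card ≤ 4 * (4 * n / 3) := by
  have key := tpp_volume_le_law_dihedralLike (A := ZMod (2 * n)) (ρ := QuaternionGroup.a)
    (τ := QuaternionGroup.xa) (c₀ := (n : ZMod (2 * n))) QuaternionGroup.a_mul_a QuaternionGroup.a_mul_xa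
    QuaternionGroup.xa_mul_a QuaternionGroup.xa_mul_xa (fun i j hij => by cases hij; rfl)
    (fun i j hij => by cases hij; rfl) (fun i j hij => by cases hij) (fun g => by
      cases g with
      | a i => exact Or.inl ⟨i, rfl⟩
      | xa i => exact Or.inr ⟨i, rfl⟩)
    (by rw [ZMod.card]; have := NeZero.ne n; omega) h
  rw [ZMod.card] at key
  have : 2 * (2 * n) = 4 * n := by ring
  rw [this] at key
  exact key

end Summit.MatrixMultiplication.OmegaCensus
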